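import Literature.Topology.FourManifolds.MMSWRasmussenFacts
import Literature.Topology.FourManifolds.PathsAvoidPoints
import Literature.AlgebraicTopology.FundamentalGroup.SphereSimplyConnected
import Summits.SmoothPoincare4.SmoothPoincare4.Theses.DottedCircleRasmussen
import Summits.SmoothPoincare4.SmoothPoincare4.Theorems.DottedCircleRasmussenDcrGapStubFriendsPi1AsmExterior
import Summits.SmoothPoincare4.SmoothPoincare4.Theorems.DottedCircleRasmussenDcrGapStubFriendsPi1AsmConnected

/-!
# Assembly reduction of stub `stub_friendsPi1` (line `mk_friends`, skeleton v2–v3, crux `DcrGap`)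
(item stmt-SmoothPoincare4-16128, route route-SmoothPoincare4-DottedCircleRasmussen)

Stub B of the line says: the friends-swap carrier `X = (D_k ∪ h²_{K₀}) ∪_Y (W₀ ∖ νΔ₁)` — a closed
`4`-manifold written as `X = j(E) ⊔ (i(D_k) ∪ f₀(𝔻²)) ⊔ {q}`, `E = ℝ⁴ ∖ (D_k ∪ Δ₁)` the model disc
exterior, `j : E ↪ X` a smooth open embedding, `q = j(∞)` — is simply connected as soon as the pushed
tube meridian `ℓ = j ∘ μ` of `Δ₁` dies in `X`.  This file proves the ASSEMBLY
`helper_friendsPi1_of_G123 : G1 → G2 → G3 → B` from the three registered sub-goals of the line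

* `G1` (`helper_friendsPi1_G1`): `ℝ⁴ ∖ D_k` is simply connected;
* `G2` (`helper_friendsPi1_G2`, Kervaire): for any continuous `ψ : E → Z` under which the tube
  meridian `μ` dies, every loop of `E` dies in `Z`;
* `G3` (`helper_friendsPi1_G3`): every loop of `X` based off the core `C = i(D_k) ∪ f₀(𝔻²)` is
  homotopic to a loop off `C`,

so that `stub_friendsPi1 := helper_friendsPi1_of_G123 helper_friendsPi1_G1 helper_friendsPi1_G2
helper_friendsPi1_G3` once the three land.  (The reduction's own signature, `(G1) → (G2) → (G3) → (B)`
verbatim, is 7176 characters, above the stub registry's 4000-character limit; the registered helper proved here is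
the abstract loop-killing step `helper_friendsPi1_asm_loops`.)

Proof of the assembly.  Base point `x₀ = j(a₀)`, `a₀ = μ(v₀)` a meridian point (the meridian lies in
`E`: `FriendsPi1.tube_meridian_not_mem`).  *Path connectedness* of `X` is
`helper_friendsPi1_asm_pathConnected` (part 2), fed with the path connectedness of `E`
(`helper_friendsPi1_asm_exterior`, part 1, from `G1`).  *Loops at `x₀`*
(`helper_friendsPi1_asm_loops`): a loop `γ` at `x₀` is homotopic to `γ' ⊂ X ∖ C` (`G3`), then to
`γ'' ⊂ X ∖ (C ∪ {q}) = j(E)` by general position with respect to the point `q` inside the open set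
`X ∖ C` (the tree's `Path.exists_homotopic_forall_ne`, Hirsch Ch. 3 Thm. 2.5), and `γ'' = j ∘ γ₀` for
a loop `γ₀` of `E` (`j` is an embedding), which dies by `G2` applied to `ψ = j`, the meridian
hypothesis being `j ∘ μ = ℓ ≃ const`.  One base point suffices
(`simplyConnectedSpace_of_loops_nullhomotopic_at`).

No definitions, no named facts, no `sorry`.
-/

-- the prescribed namespace `Summit.<P>.<Sub>.…` duplicates `SmoothPoincare4` (P = Sub)
set_option linter.dupNamespace false
set_option linter.style.longLine false

noncomputable section

open scoped Manifold ContDiff Topology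
open Function Set Metric
open Literature.Topology.FourManifolds Literature.Topology.FourManifolds.MMSW
open Literature.AlgebraicTopology.FundamentalGroup

namespace Summit.SmoothPoincare4.SmoothPoincare4.Theorems.DcrGap.MkFriends

/-! ## Killing loops through the embedded exterior -/

/-- **Loops die in `X` if they can be pushed into the image of an embedding where they die**
(registered helper `helper_friendsPi1_asm_loops` of line `mk_friends`).  Let `X` be a closed
`4`-manifold, `ψ : Y ↪ X` an embedding with `range ψ = (C ∪ {q})ᶜ`, `C` closed.  If every loop at
`ψ a₀` is homotopic to one missing `C`, and every loop of `Y` at `a₀` dies in `X` under `ψ`, then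
every loop at `ψ a₀` dies: push it off `C`, then off the point `q` inside the open set `Cᶜ` (general
position, the tree's `Path.exists_homotopic_forall_ne`), lift it through `ψ` and kill it.
[cite: HirschDT1976, Ch. 3 Thm. 2.5] -/
theorem helper_friendsPi1_asm_loops : ∀ (X : Type) [TopologicalSpace X] [T2Space X] [CompactSpace X] [ChartedSpace (EuclideanSpace ℝ (Fin 4)) X] [IsManifold (𝓡 4) ((⊤ : ℕ∞) : WithTop ℕ∞) X] (Y : Type) [TopologicalSpace Y] (ψ : C(Y, X)) (C : Set X) (q : X) (a₀ : Y), IsClosed C → Topology.IsEmbedding ψ → Set.range ψ = (C ∪ {q})ᶜ → (∀ γ : Path (ψ a₀) (ψ a₀), ∃ γ' : Path (ψ a₀) (ψ a₀), (∀ t, γ' t ∉ C) ∧ γ.Homotopic γ') → (∀ γ : Path a₀ a₀, (γ.map ψ.continuous).Homotopic (Path.refl (ψ a₀))) → ∀ γ : Path (ψ a₀) (ψ a₀), γ.Homotopic (Path.refl (ψ a₀)) := by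
  intro X _ _ _ _ _ Y _ ψ C q a₀ hC hemb hrange hoff hkill γ
  -- the base point is off `C` and is not `q`
  have hx₀ : ψ a₀ ∈ (C ∪ {q})ᶜ := hrange ▸ mem_range_self a₀
  have hx₀q : ψ a₀ ≠ q := fun h => hx₀ (Or.inr h)
  -- push `γ` off `C`
  obtain ⟨γ₁, hγ₁C, hγγ₁⟩ := hoff γ
  -- push `γ₁` off the point `q`, inside the open set `Cᶜ`
  obtain ⟨γ₂, hγ₂q, hγ₂C, hγ₁γ₂⟩ : ∃ γ₂ : Path (ψ a₀) (ψ a₀),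
      (∀ t, γ₂ t ≠ q) ∧ (∀ t, γ₂ t ∉ C) ∧ γ₁.Homotopic γ₂ := by
    by_cases hq : q ∈ C
    · exact ⟨γ₁, fun t h => hγ₁C t (h ▸ hq), hγ₁C, Path.Homotopic.refl γ₁⟩
    · obtain ⟨U, hUo, hUy, hU⟩ := exists_cover_homotopic_of_mapsTo (n := 4) X
      obtain ⟨γ₂, hγ₂q, hloc, hhom⟩ :=
        Literature.Topology.FourManifolds.Path.exists_homotopic_forall_ne (n := 4) (by norm_num) hUo hUy
          (fun f g h => hU f g h) γ₁ q hx₀q hx₀q hC.isOpen_compl hq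
      refine ⟨γ₂, hγ₂q, fun t => ?_, hhom⟩
      rcases hloc t with h | ⟨-, h⟩
      · rw [h]; exact hγ₁C t
      · exact h
  -- `γ₂` runs in `range ψ`: lift it through the embedding
  have hγ₂r : ∀ t, γ₂ t ∈ range ψ := fun t => by
    rw [hrange]
    rintro (h | h)
    · exact hγ₂C t h
    · exact hγ₂q t h
  set Φ := hemb.toHomeomorph with hΦ
  have hsymm : ∀ p : range ψ, ψ (Φ.symm p) = p := fun p => by
    conv_rhs => rw [← Φ.apply_symm_apply p]
    rfl
  have hends : Φ.symm ⟨ψ a₀, mem_range_self a₀⟩ = a₀ := hemb.toHomeomorph_symm_apply a₀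
  let γ₀ : Path a₀ a₀ :=
    { toFun := fun t => Φ.symm ⟨γ₂ t, hγ₂r t⟩
      continuous_toFun := Φ.symm.continuous.comp (γ₂.continuous.subtype_mk _)
      source' := by
        have h : (⟨γ₂ 0, hγ₂r 0⟩ : range ψ) = ⟨ψ a₀, mem_range_self a₀⟩ := Subtype.ext γ₂.source
        simp only [h, hends]
      target' := by
        have h : (⟨γ₂ 1, hγ₂r 1⟩ : range ψ) = ⟨ψ a₀, mem_range_self a₀⟩ := Subtype.ext γ₂.target
        simp only [h, hends] }
  have hmap : γ₀.map ψ.continuous = γ₂ := by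
    ext t
    exact hsymm ⟨γ₂ t, hγ₂r t⟩
  have hγ₂ : γ₂.Homotopic (Path.refl (ψ a₀)) := hmap ▸ hkill γ₀
  exact (hγγ₁.trans hγ₁γ₂).trans hγ₂

/-! ## The assembly `B ⇐ G1 ∧ G2 ∧ G3` -/

/-- **Assembly of stub `stub_friendsPi1` from the registered sub-goals `G1`, `G2`, `G3`** (verbatim
`(G1) → (G2) → (G3) → (B)`; see the module docstring).  [cite: ManolescuPiccirillo2023, §3.2, proof of
Lemma 3.3] [cite: HirschDT1976, Ch. 3 Thm. 2.5] -/
theorem helper_friendsPi1_of_G123 : (∀ (k : ℕ), SimplyConnectedSpace {x : EuclideanSpace ℝ (Fin 4) // x ∉ Literature.Topology.FourManifolds.MMSW.modelHandlebody k}) → (∀ (k : ℕ) (K₁ : (Metric.sphere (0 : EuclideanSpace ℝ (Fin 2)) 1) → EuclideanSpace ℝ (Fin 4)) (f₁ : EuclideanSpace ℝ (Fin 2) → EuclideanSpace ℝ (Fin 4)) (T : EuclideanSpace ℝ (Fin 2) × EuclideanSpace ℝ (Fin 2) → EuclideanSpace ℝ (Fin 4)), Literature.Topology.FourManifolds.MMSW.IsModelKnot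 k K₁ → Literature.Topology.FourManifolds.MMSW.IsModelSliceDisc k K₁ f₁ → (ContDiffOn ℝ ((⊤ : ℕ∞) : WithTop ℕ∞) T (Metric.ball (0 : EuclideanSpace ℝ (Fin 2)) 1 ×ˢ Metric.ball (0 : EuclideanSpace ℝ (Fin 2)) 2) ∧ Set.InjOn T (Metric.ball (0 : EuclideanSpace ℝ (Fin 2)) 1 ×ˢ Metric.ball (0 : EuclideanSpace ℝ (Fin 2)) 2) ∧ (∀ q ∈ Metric.ball (0 : EuclideanSpace ℝ (Fin 2)) 1 ×ˢ Metric.ball (0 : EuclideanSpace ℝ (Fin 2)) 2, Function.Injective (fderiv ℝ T q)) ∧ (∀ q ∈ Metric.ball (0 : EuclideanSpace ℝ (Fin 2)) 1 ×ˢ Metric.ball (0 : EuclideanSpace ℝ (Fin 2)) 2, T q ∉ Literature.Topology.FourManifolds.MMSW.modelHandlebody k) ∧ (∀ x ∈ Metric.ball (0 : EuclideanSpace ℝ (Fin 2)) 1, T (x, 0) = f₁ x)) → SimplyConnectedSpace {x : EuclideanSpace ℝ (Fin 4) // x ∉ Literature.Topology.FourManifolds.MMSW.modelHandlebody k} → ∀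 (E : TopologicalSpace.Opens (EuclideanSpace ℝ (Fin 4))), ((E : Set (EuclideanSpace ℝ (Fin 4))) = {x | x ∉ Literature.Topology.FourManifolds.MMSW.modelHandlebody k ∧ x ∉ f₁ '' Metric.closedBall (0 : EuclideanSpace ℝ (Fin 2)) 1}) → ∀ (Z : Type) [TopologicalSpace Z] (ψ : C(E, Z)) (μ : C((Metric.sphere (0 : EuclideanSpace ℝ (Fin 2)) 1), E)), (∀ v : (Metric.sphere (0 : EuclideanSpace ℝ (Fin 2)) 1), ((μ v : E) : EuclideanSpace ℝ (Fin 4)) = T ((0 : EuclideanSpace ℝ (Fin 2)), (1 / 2 : ℝ) • (v : EuclideanSpace ℝ (Fin 2)))) → (∃ z₀ : Z, (ψ.comp μ).Homotopic (ContinuousMap.const (Metric.sphere (0 : EuclideanSpace ℝ (Fin 2)) 1) z₀)) → ∀ (a : E) (γ : Path a a), (γ.map ψ.continuous).Homotopic (Path.refl (ψ a))) → (∀ (k : ℕ) (K₀ : (Metric.sphere (0 : EuclideanSpace ℝ (Fin 2)) 1) → EuclideanSpace ℝ (Fin 4)), Literature.Topology.FourManifolds.MMSW.IsModelKnot k K₀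 → ∀ (X : Type) [TopologicalSpace X] [T2Space X] [SecondCountableTopology X] [ChartedSpace (EuclideanSpace ℝ (Fin 4)) X] [IsManifold (𝓡 4) ((⊤ : ℕ∞) : WithTop ℕ∞) X] [CompactSpace X] (U : Set (EuclideanSpace ℝ (Fin 4))) (i : EuclideanSpace ℝ (Fin 4) → X) (f₀ : EuclideanSpace ℝ (Fin 2) → X) (g₀ : EuclideanSpace ℝ (Fin 2) → EuclideanSpace ℝ (Fin 4)), (IsOpen U ∧ Literature.Topology.FourManifolds.MMSW.modelHandlebody k ⊆ U ∧ ContMDiffOn (𝓡 4) (𝓡 4) ((⊤ : ℕ∞) : WithTop ℕ∞) i U ∧ Set.InjOn i U ∧ (∀ x ∈ U, Function.Injective (mfderiv (𝓡 4) (𝓡 4) i x))) → (ContMDiff (𝓡 2) (𝓡 4) ((⊤ : ℕ∞) : WithTop ℕ∞) f₀ ∧ Set.InjOn f₀ (Metric.closedBall (0 : EuclideanSpace ℝ (Fin 2)) 1) ∧ (∀ x ∈ Metric.closedBall (0 : EuclideanSpace ℝ (Fin 2)) 1, Function.Injective (mfderiv (𝓡 2) (𝓡 4) f₀ x)) ∧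 (∀ x : EuclideanSpace ℝ (Fin 2), ‖x‖ < 1 → f₀ x ∉ i '' Literature.Topology.FourManifolds.MMSW.modelHandlebody k) ∧ (∀ t : (Metric.sphere (0 : EuclideanSpace ℝ (Fin 2)) 1), f₀ t = i (K₀ t)) ∧ ContDiff ℝ ((⊤ : ℕ∞) : WithTop ℕ∞) g₀ ∧ (∃ η : ℝ, 0 < η ∧ (∀ x : EuclideanSpace ℝ (Fin 2), 1 - η < ‖x‖ → ‖x‖ ≤ 1 → g₀ x ∈ U ∧ f₀ x = i (g₀ x))) ∧ (∀ t : (Metric.sphere (0 : EuclideanSpace ℝ (Fin 2)) 1), deriv (fun ρ : ℝ => Literature.Topology.FourManifolds.MMSW.levelFun k (g₀ (ρ • (t : EuclideanSpace ℝ (Fin 2))))) 1 < 0)) → ∀ (x : X), x ∉ (i '' Literature.Topology.FourManifolds.MMSW.modelHandlebody k ∪ f₀ '' Metric.closedBall (0 : EuclideanSpace ℝ (Fin 2)) 1) → ∀ (γ : Path x x), ∃ γ' : Path x x, (∀ t, γ' t ∉ (i '' Literature.Topology.FourManifolds.MMSW.modelHandlebody k ∪ f₀ '' Metric.closedBall (0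 : EuclideanSpace ℝ (Fin 2)) 1)) ∧ γ.Homotopic γ') → (∀ (k : ℕ) (K₀ K₁ : (Metric.sphere (0 : EuclideanSpace ℝ (Fin 2)) 1) → EuclideanSpace ℝ (Fin 4)) (f₁ : EuclideanSpace ℝ (Fin 2) → EuclideanSpace ℝ (Fin 4)) (T : EuclideanSpace ℝ (Fin 2) × EuclideanSpace ℝ (Fin 2) → EuclideanSpace ℝ (Fin 4)), Literature.Topology.FourManifolds.MMSW.IsModelKnot k K₀ → Literature.Topology.FourManifolds.MMSW.IsModelKnot k K₁ → Literature.Topology.FourManifolds.MMSW.IsModelSliceDisc k K₁ f₁ → (ContDiffOn ℝ ((⊤ : ℕ∞) : WithTop ℕ∞) T (Metric.ball (0 : EuclideanSpace ℝ (Fin 2)) 1 ×ˢ Metric.ball (0 : EuclideanSpace ℝ (Fin 2)) 2) ∧ Set.InjOn T (Metric.ball (0 : EuclideanSpace ℝ (Fin 2)) 1 ×ˢ Metric.ball (0 : EuclideanSpace ℝ (Fin 2)) 2) ∧ (∀ q ∈ Metric.ball (0 : EuclideanSpace ℝ (Fin 2)) 1 ×ˢ Metric.ball (0 : EuclideanSpace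 ℝ (Fin 2)) 2, Function.Injective (fderiv ℝ T q)) ∧ (∀ q ∈ Metric.ball (0 : EuclideanSpace ℝ (Fin 2)) 1 ×ˢ Metric.ball (0 : EuclideanSpace ℝ (Fin 2)) 2, T q ∉ Literature.Topology.FourManifolds.MMSW.modelHandlebody k) ∧ (∀ x ∈ Metric.ball (0 : EuclideanSpace ℝ (Fin 2)) 1, T (x, 0) = f₁ x)) → ∀ (X : Type) [TopologicalSpace X] [T2Space X] [SecondCountableTopology X] [ChartedSpace (EuclideanSpace ℝ (Fin 4)) X] [IsManifold (𝓡 4) ((⊤ : ℕ∞) : WithTop ℕ∞) X] [CompactSpace X] (U : Set (EuclideanSpace ℝ (Fin 4))) (i : EuclideanSpace ℝ (Fin 4) → X) (f₀ : EuclideanSpace ℝ (Fin 2) → X) (g₀ : EuclideanSpace ℝ (Fin 2) → EuclideanSpace ℝ (Fin 4)) (E : TopologicalSpace.Opens (EuclideanSpace ℝ (Fin 4))) (j : E → X) (q : X) (m : (Metric.sphere (0 : EuclideanSpace ℝ (Fin 2)) 1) → EuclideanSpace ℝ (Fin 4)) (ℓ : C((Metric.sphere (0 : EuclideanSpace ℝ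 (Fin 2)) 1), X)), (IsOpen U ∧ Literature.Topology.FourManifolds.MMSW.modelHandlebody k ⊆ U ∧ ContMDiffOn (𝓡 4) (𝓡 4) ((⊤ : ℕ∞) : WithTop ℕ∞) i U ∧ Set.InjOn i U ∧ (∀ x ∈ U, Function.Injective (mfderiv (𝓡 4) (𝓡 4) i x))) → (ContMDiff (𝓡 2) (𝓡 4) ((⊤ : ℕ∞) : WithTop ℕ∞) f₀ ∧ Set.InjOn f₀ (Metric.closedBall (0 : EuclideanSpace ℝ (Fin 2)) 1) ∧ (∀ x ∈ Metric.closedBall (0 : EuclideanSpace ℝ (Fin 2)) 1, Function.Injective (mfderiv (𝓡 2) (𝓡 4) f₀ x)) ∧ (∀ x : EuclideanSpace ℝ (Fin 2), ‖x‖ < 1 → f₀ x ∉ i '' Literature.Topology.FourManifolds.MMSW.modelHandlebody k) ∧ (∀ t : (Metric.sphere (0 : EuclideanSpace ℝ (Fin 2)) 1), f₀ t = i (K₀ t)) ∧ ContDiff ℝ ((⊤ : ℕ∞) : WithTop ℕ∞) g₀ ∧ (∃ η : ℝ, 0 < η ∧ (∀ x : EuclideanSpace ℝ (Fin 2), 1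 - η < ‖x‖ → ‖x‖ ≤ 1 → g₀ x ∈ U ∧ f₀ x = i (g₀ x))) ∧ (∀ t : (Metric.sphere (0 : EuclideanSpace ℝ (Fin 2)) 1), deriv (fun ρ : ℝ => Literature.Topology.FourManifolds.MMSW.levelFun k (g₀ (ρ • (t : EuclideanSpace ℝ (Fin 2))))) 1 < 0)) → (((E : Set (EuclideanSpace ℝ (Fin 4))) = {x | x ∉ Literature.Topology.FourManifolds.MMSW.modelHandlebody k ∧ x ∉ f₁ '' Metric.closedBall (0 : EuclideanSpace ℝ (Fin 2)) 1}) ∧ Manifold.IsSmoothEmbedding (𝓡 4) (𝓡 4) ((⊤ : ℕ∞) : WithTop ℕ∞) j ∧ IsOpen (Set.range j) ∧ Set.range j = (i '' Literature.Topology.FourManifolds.MMSW.modelHandlebody k ∪ f₀ '' Metric.closedBall (0 : EuclideanSpace ℝ (Fin 2)) 1 ∪ {q})ᶜ ∧ (∀ s ∈ nhds q, ∃ R : ℝ, ∀ a : E, R < ‖(a : EuclideanSpace ℝ (Fin 4))‖ → j a ∈ s)) → (∀ v : (Metric.sphere (0 : EuclideanSpace ℝ (Fin 2)) 1), m v = T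 ((0 : EuclideanSpace ℝ (Fin 2)), (1 / 2 : ℝ) • (v : EuclideanSpace ℝ (Fin 2)))) → (∀ (v : (Metric.sphere (0 : EuclideanSpace ℝ (Fin 2)) 1)) (a : E), (a : EuclideanSpace ℝ (Fin 4)) = m v → ℓ v = j a) → (∃ x₀ : X, ℓ.Homotopic (ContinuousMap.const (Metric.sphere (0 : EuclideanSpace ℝ (Fin 2)) 1) x₀)) → SimplyConnectedSpace X) := by
  intro hG1 hG2 hG3 k K₀ K₁ f₁ T hK₀ hK₁ hf₁ hT X _ _ _ _ _ _ U i f₀ g₀ E j q m ℓ hGerm hDisc hExt hm hℓ hnull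
  obtain ⟨hE, hjemb, -, hrange, hq⟩ := hExt
  have hjE : Topology.IsEmbedding j := hjemb.isEmbedding
  have hjc : Continuous j := hjE.continuous
  -- the tube meridian is a continuous loop of `E`
  have hmemE : ∀ v, m v ∈ E := fun v => by
    show m v ∈ (E : Set (EuclideanSpace ℝ (Fin 4)))
    rw [hE, hm v]
    exact FriendsPi1.tube_meridian_not_mem hK₁ hf₁ hT v
  have hmc : Continuous m := by
    have h : m = fun v : (Metric.sphere (0 : EuclideanSpace ℝ (Fin 2)) 1) =>
        T ((0 : EuclideanSpace ℝ (Fin 2)), (1 / 2 : ℝ) • (v : EuclideanSpace ℝ (Fin 2))) :=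
      funext hm
    rw [h]
    exact FriendsPi1.continuous_tube_meridian hT
  let μ : C((Metric.sphere (0 : EuclideanSpace ℝ (Fin 2)) 1), E) := ⟨fun v => ⟨m v, hmemE v⟩, hmc.subtype_mk _⟩
  let ψ : C(E, X) := ⟨j, hjc⟩
  have hμ : ∀ v : (Metric.sphere (0 : EuclideanSpace ℝ (Fin 2)) 1),
      ((μ v : E) : EuclideanSpace ℝ (Fin 4)) =
        T ((0 : EuclideanSpace ℝ (Fin 2)), (1 / 2 : ℝ) • (v : EuclideanSpace ℝ (Fin 2))) := fun v => hm v
  have hψμ : ψ.comp μ = ℓ := by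
    ext v
    exact (hℓ v ⟨m v, hmemE v⟩ rfl).symm
  have hnull' : ∃ z₀ : X, (ψ.comp μ).Homotopic
      (ContinuousMap.const (Metric.sphere (0 : EuclideanSpace ℝ (Fin 2)) 1) z₀) := by
    rw [hψμ]
    exact hnull
  -- G2: every loop of `E` dies in `X`
  have hkill := hG2 k K₁ f₁ T hK₁ hf₁ hT (hG1 k) E hE X ψ μ hμ hnull'
  -- base point
  let v₀ : (Metric.sphere (0 : EuclideanSpace ℝ (Fin 2)) 1) := ⟨EuclideanSpace.single 0 1, by simp⟩
  let a₀ : E := μ v₀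
  -- the core is closed and the base point is off it
  set C : Set X := i '' modelHandlebody k ∪ f₀ '' closedBall (0 : EuclideanSpace ℝ (Fin 2)) 1 with hCdef
  have hi : ContinuousOn i U := hGerm.2.2.1.continuousOn
  have hCclosed : IsClosed C :=
    (((isCompact_modelHandlebody k).image_of_continuousOn (hi.mono hGerm.2.1)).union
      ((isCompact_closedBall _ _).image hDisc.1.continuous)).isClosed
  have hx₀ : ψ a₀ ∉ C := fun h => by
    have h' : ψ a₀ ∈ range j := mem_range_self a₀
    rw [hrange] at h'
    exact h' (Or.inl h)
  -- path connectedness of `X`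
  have hDpc : IsPathConnected {x : EuclideanSpace ℝ (Fin 4) | x ∉ modelHandlebody k} := by
    haveI := hG1 k
    exact isPathConnected_iff_pathConnectedSpace.2
      (inferInstance : PathConnectedSpace {x : EuclideanSpace ℝ (Fin 4) // x ∉ modelHandlebody k})
  have hEpc : IsPathConnected (E : Set (EuclideanSpace ℝ (Fin 4))) := by
    rw [hE]
    exact helper_friendsPi1_asm_exterior k K₁ f₁ hK₁ hf₁ hDpc
  have hEunb : ∀ R : ℝ, ∃ a : E, R < ‖(a : EuclideanSpace ℝ (Fin 4))‖ := fun R => by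
    obtain ⟨x, hxR, hxD, hxf⟩ := FriendsPi1.exists_norm_gt_mem hf₁ R
    have hxE : x ∈ E := by
      show x ∈ (E : Set (EuclideanSpace ℝ (Fin 4)))
      rw [hE]
      exact ⟨hxD, hxf⟩
    exact ⟨⟨x, hxE⟩, hxR⟩
  haveI : PathConnectedSpace X :=
    helper_friendsPi1_asm_pathConnected k X U i f₀ E j q hGerm.1 hGerm.2.1 hi hGerm.2.2.2.1 hDisc.1
      hDisc.2.2.2.1 hEpc hEunb hjc hrange hq
  -- loops at the base point die
  have hloops : ∀ γ : Path (ψ a₀) (ψ a₀), γ.Homotopic (Path.refl (ψ a₀)) :=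
    helper_friendsPi1_asm_loops X E ψ C q a₀ hCclosed hjE hrange
      (hG3 k K₀ hK₀ X U i f₀ g₀ hGerm hDisc (ψ a₀) hx₀) (hkill a₀)
  exact simplyConnectedSpace_of_loops_nullhomotopic_at (ψ a₀) hloops

end Summit.SmoothPoincare4.SmoothPoincare4.Theorems.DcrGap.MkFriends

end
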